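import Summits.BirchSwinnertonDyer.Rank1Residual.X5.SelmerSolitaireQuadraticNormalFormLemmas
import HarnessLib

/-!
# X5 · Selmer solitaire, quadratic layer — QS1 NORMAL FORM and QS1u UNIQUENESS (lens-2 T3):
# every totally singular Lagrangian of `Q_D` with `∅` core is `𝒰(P, b)`, and `(P, b)` is unique

HONEST FRAMING (cell `b2b-bsdres`, run/shared/lean/b2b/bsd-rank1-residual/, verbatim in every
file): the goal of the cell is to DELETE the COMBINATION-SHAPED residual classes of the
Birch–Swinnerton-Dyer formula for ALL analytic-rank `≤ 1` elliptic curves over `ℚ` — "full BSD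
formula for every rank `≤ 1` curve in class `C`" assembled STRICTLY from published theorems — so
that the rank-`≤ 1` remainder becomes exactly the CONSTRUCTION-SHAPED classes, which are TYPED
(missing-input `Prop`s), NOT attempted. This is not "finishing BSD". O1 team (class X5, `p = 2`,
non-CM), ORDER v2.9 pool slot (ii‴) = lens-2 GEN 10's QUADRATIC-SPACE LAYER (o1 lead R-G20.3 /
R-G20.4), item **Q3**; pool hand = seat `b2b-bsdres-x11b3-p2` GEN 6 (x11b3 prover released to the o1
pool; yields to x11b3 deals). PURE `𝔽₂` LINEAR ALGEBRA about the vocabulary of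
`X5/SelmerSolitaireQuadratic.lean` (x11b3-p4, p283641; spelling of record = lens-2's seat sketch
`HOME/b2b-bsdres-o1-idea-2-g10/lean/O1Stub1QuadraticSketch.lean`): THEOREMS ONLY (no definition, no
named fact, no `sorry`); nothing arithmetic is asserted (the dictionary AR1–AR4 to Selmer groups is
NOT here); reach-neutral (R1 closes no class); nothing booked; O1 OPEN.

This file PROVES two of the word-shapes of `X5/SelmerSolitaireQuadratic.lean`, VERBATIM:
* `normalForm_holds : NormalForm` (QS1 = lens-2 T3): `∀ s U, IsTSLagrangian U → CoreQ U ∅ →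
  ∃ P b, U = nfSpace P b`;
* `normalFormUnique_holds : NormalFormUnique` (QS1u): `nfSpace P b = nfSpace P' b' → P = P' ∧ b = b'`.

PROOF of QS1 (`NF.exists_normalForm`; the kernel shape of the algorithm `normal_form()` of lens-2's
`code/qs_layer_check.py`): the bookkeeping map `x ↦ (t-coordinates of x, x_∞.1 + x_∞.2)`,
`U → 𝔽₂^D × 𝔽₂`, is injective on a totally singular `U` with `∅` core (kernel triviality:
`q(x) = x_∞.1 · x_∞.2` on vectors with no `t`-part), hence bijective since `finrank U = s + 1`
(Mathlib `LinearMap.injective_iff_surjective_of_finrank_eq_finrank`); `c_∅ :=` the preimage of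
`(0, 1)` has `∞`-part `lineOf b` — THE type bit; `d_ℓ :=` the preimage of `(e_ℓ, 0)` corrected by
`c_∅` to have `λ_b`-coordinate `0`; `Ŝ(l, ℓ) := u_l(d_ℓ)`, `Ŝ(ℓ, ∞) := u_ℓ(c_∅)`, `Ŝ(∞, ∞) := 0`;
the vanishing of `q` and of its polar form on `U` makes `Ŝ` symmetric with zero diagonal and shows
that the `λ′`-coordinate of `d_ℓ` is `Ŝ(ℓ, ∞)`, whence `nfVec P b ε z = ε • c_∅ + Σ z_ℓ • d_ℓ` and
`U = nfSpace P b` (no basis bookkeeping: `⊇` by membership, `⊆` by kernel triviality again).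
PROOF of QS1u (`NF.nfSpace_injective`): the non-zero vector of `𝒰(P, b)` with no `t`-part is
`nfVec P b 1 0` with `∞`-part `lineOf b`; the vector with `t`-part `e_ℓ` and `λ_b`-coordinate `0` is
`nfVec P b 0 e_ℓ`, whose `u`-coordinates and `λ′`-coordinate are the `ℓ`-th column of `Ŝ`.
Exec evidence (lens-2, EVIDENCE only): exhaustive `|D| ≤ 3`, QS1 nf reproduced 128/128 and
QS1 + QS1u count-checked as a bijection (`2·2^{C(|D|+1,2)}` `∅`-core Lagrangians).

References: lens-2 GEN 5 (G5.2, T3) and GEN 10 (2G10.2); Mazur–Rubin, Contemp. Math. 358 (2004)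
§4.3 [cite: MazurRubin2004Intro, §4.3]; Poonen–Rains, JAMS 25 (2012) §4 [cite: PoonenRains2012, §4];
A. Bouchet, *Graphic presentations of isotropic systems*, JCTB 45 (1988) Thm. 4 (every isotropic
system has a graphic presentation — QS1 is its `q`-refined form with a marked vertex). Folklore.
-/

namespace Summit.BirchSwinnertonDyer.Rank1Residual.X5.SelmerSolitaire.Quadratic

open Finset SelmerSolitaire

namespace NF

variable {s : ℕ}

/-! ### §1 QS1: existence of the normal form -/

/-- **QS1, the construction.** A totally singular Lagrangian `U ⊆ Q_D` with `∅` core is `𝒰(P, b)`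
for a position `P` and a type bit `b`: the bookkeeping map `x ↦ (t-coordinates, x_∞.1 + x_∞.2)` is
injective on `U` (kernel triviality), hence bijective (`finrank U = s + 1`); `c_∅ :=` the preimage of
`(0, 1)` has `∞`-part `lineOf b` (the type bit); `d_ℓ :=` the preimage of `(e_ℓ, 0)` corrected by
`c_∅` to have `λ_b`-coordinate `0`; `Ŝ(l, ℓ) := u_l(d_ℓ)`, `Ŝ(ℓ, ∞) := u_ℓ(c_∅)`; total singularity
(vanishing of `q` and of the polar form on `U`) makes `Ŝ` symmetric with zero diagonal and identifies
the `λ′`-coordinate of `d_ℓ` with `Ŝ(ℓ, ∞)`, so that `nfVec P b ε z = ε·c_∅ + Σ z_ℓ·d_ℓ`. (lens-2 G5.2,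
T3; the algorithm `normal_form()` of `code/qs_layer_check.py`.) [folklore] -/
theorem exists_normalForm {U : Submodule (ZMod 2) (QVec s)} (hU : IsTSLagrangian U)
    (hcore : CoreQ U ∅) : ∃ (P : Position s) (b : Bool), U = nfSpace P b := by
  classical
  obtain ⟨hq, hdim⟩ := hU
  have hker : ∀ x ∈ U, (∀ i, (x (some i)).2 = 0) → (x none).1 + (x none).2 = 0 → x = 0 :=
    fun x hx ht hs ↦ eq_zero_of_snd_eq_zero_of_sum_eq_zero hq hcore hx ht hs
  have hpol : ∀ x ∈ U, ∀ y ∈ U, polar x y = 0 := fun x hx y hy ↦ polar_eq_zero_of_mem hq hx hy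
  -- the bookkeeping map
  let T : QVec s →ₗ[ZMod 2] (Fin s → ZMod 2) × ZMod 2 :=
    { toFun := fun x ↦ (fun i ↦ (x (some i)).2, (x none).1 + (x none).2)
      map_add' := fun x y ↦ by
        ext i
        · simp
        · simp only [Pi.add_apply, Prod.fst_add, Prod.snd_add, Prod.mk_add_mk]
          ring
      map_smul' := fun c x ↦ by
        ext i
        · simp
        · simp only [Pi.smul_apply, Prod.smul_fst, Prod.smul_snd, smul_eq_mul, RingHom.id_apply,
            Prod.smul_mk, mul_add] }
  have hT : ∀ x : QVec s, T x = (fun i ↦ (x (some i)).2, (x none).1 + (x none).2) := fun _ ↦ rfl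
  let π : ↥U →ₗ[ZMod 2] (Fin s → ZMod 2) × ZMod 2 := T.comp U.subtype
  have hπ : ∀ x : ↥U, π x = (fun i ↦ ((x : QVec s) (some i)).2,
      ((x : QVec s) none).1 + ((x : QVec s) none).2) := fun _ ↦ rfl
  have hinj : Function.Injective π := by
    refine (injective_iff_map_eq_zero π).mpr fun x hx ↦ ?_
    rw [hπ, Prod.mk_eq_zero] at hx
    exact Subtype.ext (hker _ x.2 (fun i ↦ congrFun hx.1 i) hx.2)
  have hfin : Module.finrank (ZMod 2) ↥U = Module.finrank (ZMod 2) ((Fin s → ZMod 2) × ZMod 2) := by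
    rw [hdim, Module.finrank_prod, Module.finrank_fintype_fun_eq_card, Fintype.card_fin,
      Module.finrank_self]
  have hsurj : Function.Surjective π :=
    (LinearMap.injective_iff_surjective_of_finrank_eq_finrank hfin).mp hinj
  -- `c_∅` and the type bit
  obtain ⟨c₀, hc₀⟩ := hsurj (0, 1)
  set c : QVec s := (c₀ : QVec s) with hcdef
  have hcU : c ∈ U := c₀.2
  rw [hπ, Prod.mk.injEq] at hc₀
  have hct : ∀ i, (c (some i)).2 = 0 := fun i ↦ congrFun hc₀.1 i
  obtain ⟨b, hcb₀⟩ := exists_eq_lineOf_of_fst_add_snd hc₀.2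
  have hcb : c none = lineOf b := hcb₀
  -- `d_ℓ`
  have hd₀ := fun ℓ : Fin s ↦ hsurj (Pi.single ℓ 1, 0)
  choose d₀ hd₀ using hd₀
  set d : Fin s → QVec s := fun ℓ ↦ (d₀ ℓ : QVec s) + lamCoord b ((d₀ ℓ : QVec s) none) • c
    with hddef
  have hdU : ∀ ℓ, d ℓ ∈ U := fun ℓ ↦ U.add_mem (d₀ ℓ).2 (U.smul_mem _ hcU)
  have hd₀' : ∀ ℓ, (fun i ↦ ((d₀ ℓ : QVec s) (some i)).2) = Pi.single ℓ 1 ∧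
      ((d₀ ℓ : QVec s) none).1 + ((d₀ ℓ : QVec s) none).2 = 0 := fun ℓ ↦ by
    have h := hd₀ ℓ
    rw [hπ, Prod.mk.injEq] at h
    exact h
  have hdt : ∀ ℓ i, (d ℓ (some i)).2 = if i = ℓ then 1 else 0 := fun ℓ i ↦ by
    have h1 := congrFun (hd₀' ℓ).1 i
    simp only [hddef, Pi.add_apply, Prod.snd_add, Pi.smul_apply, Prod.smul_snd, smul_eq_mul, hct i,
      mul_zero, add_zero, h1, Pi.single_apply]
  have hdlam : ∀ ℓ, lamCoord b (d ℓ none) = 0 := fun ℓ ↦ by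
    simp only [hddef, Pi.add_apply, Pi.smul_apply, lamCoord_add, lamCoord_smul, hcb,
      (lamCoord_lineOf b).1, mul_one, CharTwo.add_self_eq_zero]
  -- `μ_ℓ •  lineOf (!b)` is the `∞`-part of `d_ℓ`
  set μ : Fin s → ZMod 2 := fun ℓ ↦ lamCoord (!b) (d ℓ none) with hμdef
  have hdnone : ∀ ℓ, d ℓ none = μ ℓ • lineOf (!b) := fun ℓ ↦ by
    have h := eq_lamCoord_smul_add b (d ℓ none)
    rw [hdlam ℓ, zero_smul, zero_add] at h
    exact h
  -- `σ_ℓ := u_ℓ(c_∅)`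
  set σ : Fin s → ZMod 2 := fun ℓ ↦ (c (some ℓ)).1 with hσdef
  have hcsome : ∀ l, c (some l) = (σ l, 0) := fun l ↦ Prod.ext rfl (hct l)
  -- polar(c, d_ℓ) = 0 ⟹ μ_ℓ = σ_ℓ
  have hμσ : ∀ ℓ, μ ℓ = σ ℓ := fun ℓ ↦ by
    have h := hpol c hcU (d ℓ) (hdU ℓ)
    rw [polar_eq, hcb, hdnone ℓ, polarInf_lineOf_smul_not] at h
    have hs : ∑ i : Fin s, ((c (some i)).1 * (d ℓ (some i)).2 + (c (some i)).2 * (d ℓ (some i)).1)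
        = σ ℓ := by
      rw [← sum_mul_ite_eq σ ℓ]
      refine Finset.sum_congr rfl fun i _ ↦ ?_
      rw [hdt ℓ i, hct i, zero_mul, add_zero]
    rw [hs] at h
    exact zmod2_add_eq_zero_iff.mp h
  -- symmetry: u_m(d_ℓ) = u_ℓ(d_m)
  have hsymm : ∀ ℓ m, (d ℓ (some m)).1 = (d m (some ℓ)).1 := fun ℓ m ↦ by
    have h := hpol (d ℓ) (hdU ℓ) (d m) (hdU m)
    rw [polar_eq, hdnone ℓ, hdnone m, polarInf_smul_lineOf_same, zero_add] at h
    have hs : ∑ i : Fin s, ((d ℓ (some i)).1 * (d m (some i)).2 + (d ℓ (some i)).2 * (d m (some i)).1)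
        = (d ℓ (some m)).1 + (d m (some ℓ)).1 := by
      rw [Finset.sum_add_distrib, ← sum_mul_ite_eq (fun i ↦ (d ℓ (some i)).1) m,
        ← sum_ite_mul_eq (fun i ↦ (d m (some i)).1) ℓ]
      congr 1
      · exact Finset.sum_congr rfl fun i _ ↦ by rw [hdt m i]
      · exact Finset.sum_congr rfl fun i _ ↦ by rw [hdt ℓ i]
    rw [hs] at h
    exact zmod2_add_eq_zero_iff.mp h
  -- zero diagonal: u_ℓ(d_ℓ) = 0
  have hloop : ∀ ℓ, (d ℓ (some ℓ)).1 = 0 := fun ℓ ↦ by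
    have h := hq (d ℓ) (hdU ℓ)
    rw [qform_eq, hdnone ℓ, smul_lineOf_fst_mul_snd, zero_add] at h
    rw [← h, ← sum_mul_ite_eq (fun i ↦ (d ℓ (some i)).1) ℓ]
    exact Finset.sum_congr rfl fun i _ ↦ by rw [hdt ℓ i]
  -- the position
  let S : Matrix (V s) (V s) (ZMod 2) := fun v w ↦
    match v, w with
    | some l, some m => (d m (some l)).1
    | some l, none => σ l
    | none, some m => σ m
    | none, none => 0
  have hSss : ∀ l m, S (some l) (some m) = (d m (some l)).1 := fun _ _ ↦ rfl
  have hSsn : ∀ l, S (some l) none = σ l := fun _ ↦ rfl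
  let P : Position s :=
    { S := S
      symm := Matrix.IsSymm.ext fun v w ↦ by
        cases v with
        | none => cases w with
          | none => rfl
          | some m => rfl
        | some l => cases w with
          | none => rfl
          | some m => exact hsymm l m
      loopless := fun v ↦ by
        cases v with
        | none => rfl
        | some l => exact hloop l }
  -- KEY IDENTITY: the explicit vectors are `ε • c + Σ z_ℓ • d_ℓ`
  have hPS : ∀ v w, P.S v w = S v w := fun _ _ ↦ rfl
  have hσ : ∀ l, (c (some l)).1 = σ l := fun _ ↦ rfl
  have key : ∀ (ε : ZMod 2) (z : Fin s → ZMod 2),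
      nfVec P b ε z = ε • c + ∑ ℓ, z ℓ • d ℓ := fun ε z ↦ by
    funext v
    cases v with
    | none =>
      simp only [nfVec_none, Pi.add_apply, Pi.smul_apply, Finset.sum_apply, hcb, hdnone, smul_smul,
        hμσ, hPS, hSsn]
      rw [Finset.sum_smul]
      congr 1
      exact Finset.sum_congr rfl fun ℓ _ ↦ by rw [mul_comm]
    | some l =>
      refine Prod.ext ?_ ?_
      · simp only [nfVec_some_fst, hPS, hSss, hSsn, Pi.add_apply, Pi.smul_apply, Finset.sum_apply,
          Prod.fst_add, Prod.smul_fst, Prod.fst_sum, smul_eq_mul, hσ]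
        rw [add_comm]
        congr 1
        exact Finset.sum_congr rfl fun ℓ _ ↦ mul_comm _ _
      · simp only [nfVec_some_snd, Pi.add_apply, Pi.smul_apply, Finset.sum_apply, Prod.snd_add,
          Prod.smul_snd, Prod.snd_sum, smul_eq_mul, hct, mul_zero, zero_add, hdt, mul_ite, mul_one,
          mul_zero, Finset.sum_ite_eq, Finset.mem_univ, if_true]
  refine ⟨P, b, le_antisymm ?_ ?_⟩
  · -- `U ≤ nfSpace P b`
    intro x hx
    set z : Fin s → ZMod 2 := fun i ↦ (x (some i)).2 with hzdef
    set ε : ZMod 2 := lamCoord b (x none) with hεdef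
    set y : QVec s := x - nfVec P b ε z with hydef
    have hnfU : nfVec P b ε z ∈ U := by
      rw [key]
      exact U.add_mem (U.smul_mem _ hcU) (U.sum_mem fun ℓ _ ↦ U.smul_mem _ (hdU ℓ))
    have hyU : y ∈ U := U.sub_mem hx hnfU
    have hyt : ∀ i, (y (some i)).2 = 0 := fun i ↦ by
      rw [hydef, Pi.sub_apply, Prod.snd_sub, nfVec_some_snd, sub_self]
    have hylam : lamCoord b (y none) = 0 := by
      rw [hydef, Pi.sub_apply, lamCoord_sub, lamCoord_nfVec_none, sub_self]
    set ν : ZMod 2 := lamCoord (!b) (y none) with hνdef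
    have hynone : y none = ν • lineOf (!b) := by
      have h := eq_lamCoord_smul_add b (y none)
      rw [hylam, zero_smul, zero_add] at h
      exact h
    -- `y - ν • c` is killed by the bookkeeping map
    have hyc : y - ν • c = 0 := by
      refine hker _ (U.sub_mem hyU (U.smul_mem _ hcU)) (fun i ↦ ?_) ?_
      · rw [Pi.sub_apply, Prod.snd_sub, hyt i, Pi.smul_apply, Prod.smul_snd, hct i, smul_zero,
          sub_zero]
      · rw [Pi.sub_apply, Pi.smul_apply, hynone, hcb, Prod.fst_sub, Prod.snd_sub]
        have h1 := lineOf_fst_add_snd (!b)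
        have h2 := lineOf_fst_add_snd b
        simp only [Prod.smul_fst, Prod.smul_snd, smul_eq_mul]
        linear_combination ν * h1 - ν * h2
    have hν : ν = 0 := by
      have h : y none = ν • lineOf b := by
        rw [sub_eq_zero] at hyc
        rw [hyc, Pi.smul_apply, hcb]
      rw [hynone] at h
      have h' : ν • lineOf (!b) = ν • lineOf (!!b) := by rw [Bool.not_not]; exact h
      exact smul_lineOf_eq_smul_lineOf_not h'
    have hy0 : y = 0 := by rw [sub_eq_zero] at hyc; rw [hyc, hν, zero_smul]
    rw [hydef, sub_eq_zero] at hy0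
    rw [hy0]
    exact nfVec_mem_nfSpace P b ε z
  · -- `nfSpace P b ≤ U`
    rw [nfSpace, Submodule.span_le]
    rintro x ⟨ε, z, rfl⟩
    rw [SetLike.mem_coe, key]
    exact U.add_mem (U.smul_mem _ hcU) (U.sum_mem fun ℓ _ ↦ U.smul_mem _ (hdU ℓ))


/-! ### §2 QS1u: uniqueness of the normal form -/

/-- **QS1u, the argument.** `nfSpace P b = nfSpace P' b'` forces `b = b'` (the unique non-zero
vector with vanishing `t`-coordinates is `nfVec · · 1 0`, with `∞`-part `lineOf b`) and `P = P'`
(the unique vector with `t`-coordinates `e_ℓ` and `λ_b`-coordinate `0` is `nfVec · b 0 e_ℓ`, whose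
`u`-coordinates and `λ′`-coordinate are the `ℓ`-th column of `Ŝ`; `Ŝ(∞, ∞) = 0` and symmetry pin the
rest). [folklore] -/
theorem nfSpace_injective {P P' : Position s} {b b' : Bool} (h : nfSpace P b = nfSpace P' b') :
    P = P' ∧ b = b' := by
  classical
  -- the type bit
  have hc : nfVec P b 1 0 ∈ nfSpace P' b' := h ▸ nfVec_mem_nfSpace P b 1 0
  obtain ⟨ε₁, z₁, hε₁⟩ := (mem_nfSpace_iff P' b' _).mp hc
  have hz₁ : z₁ = 0 := by
    funext i
    have hi := congrArg (fun x : QVec s ↦ (x (some i)).2) hε₁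
    simp only [nfVec_some_snd, Pi.zero_apply] at hi
    exact hi.symm
  have hbb : b = b' := by
    have hn := congrArg (fun x : QVec s ↦ x none) hε₁
    simp only [nfVec_none, hz₁, Pi.zero_apply, mul_zero, Finset.sum_const_zero, zero_smul, add_zero,
      one_smul] at hn
    exact lineOf_eq_smul_lineOf hn
  subst hbb
  refine ⟨?_, rfl⟩
  -- the columns `d_ℓ`
  have hd : ∀ ℓ : Fin s, nfVec P b 0 (Pi.single ℓ 1) = nfVec P' b 0 (Pi.single ℓ 1) := fun ℓ ↦ by
    have hm : nfVec P b 0 (Pi.single ℓ 1) ∈ nfSpace P' b := h ▸ nfVec_mem_nfSpace P b 0 _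
    obtain ⟨ε₂, z₂, hε₂⟩ := (mem_nfSpace_iff P' b _).mp hm
    have hz₂ : z₂ = Pi.single ℓ 1 := by
      funext i
      have hi := congrArg (fun x : QVec s ↦ (x (some i)).2) hε₂
      simp only [nfVec_some_snd] at hi
      exact hi.symm
    have hε₂' : ε₂ = 0 := by
      have hi := congrArg (fun x : QVec s ↦ lamCoord b (x none)) hε₂
      simp only [lamCoord_nfVec_none] at hi
      exact hi.symm
    rw [hε₂, hz₂, hε₂']
  have hss : ∀ l ℓ : Fin s, P.S (some l) (some ℓ) = P'.S (some l) (some ℓ) := fun l ℓ ↦ by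
    have hi := congrArg (fun x : QVec s ↦ (x (some l)).1) (hd ℓ)
    simp only [nfVec_some_fst, zero_mul, add_zero, Pi.single_apply, mul_ite, mul_one, mul_zero,
      Finset.sum_ite_eq', Finset.mem_univ, if_true] at hi
    exact hi
  have hsn : ∀ ℓ : Fin s, P.S (some ℓ) none = P'.S (some ℓ) none := fun ℓ ↦ by
    have hi := congrArg (fun x : QVec s ↦ lamCoord (!b) (x none)) (hd ℓ)
    simp only [lamCoord_not_nfVec_none, Pi.single_apply, mul_ite, mul_one, mul_zero,
      Finset.sum_ite_eq', Finset.mem_univ, if_true] at hi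
    exact hi
  -- `Position` extensionality
  obtain ⟨S, hS, hl⟩ := P
  obtain ⟨S', hS', hl'⟩ := P'
  simp only at hss hsn
  have hSS : S = S' := by
    ext v w
    cases v with
    | none =>
      cases w with
      | none => rw [hl none, hl' none]
      | some m => rw [hS.apply (some m) none, hS'.apply (some m) none, hsn m]
    | some l =>
      cases w with
      | none => exact hsn l
      | some m => exact hss l m
  subst hSS
  rfl

end NF

/-! ### §3 The statements of record -/

/-- **QS1 (NORMAL FORM, lens-2 T3) — PROVED**: every totally singular Lagrangian of `Q_D` with `∅`
core is `𝒰(P, b)` for a position `P` (simple graph on `D ⊔ {∞}`) and a type bit `b`.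
(Statement = `NormalForm` of `X5/SelmerSolitaireQuadratic.lean`, verbatim.) [folklore] -/
theorem normalForm_holds : SelmerSolitaire.Quadratic.NormalForm :=
  fun _ _ hU hcore ↦ NF.exists_normalForm hU hcore

/-- **QS1u (UNIQUENESS OF THE NORMAL FORM) — PROVED**: `nfSpace P b = nfSpace P' b' → P = P' ∧ b = b'`
(`(P, b) ↦ 𝒰(P, b)` is injective; with QS1, a bijection onto the `∅`-core totally singular
Lagrangians — count-checked `2·2^{C(|D|+1,2)}` by lens-2's `qs_layer_check.py`). [folklore] -/
theorem normalFormUnique_holds : SelmerSolitaire.Quadratic.NormalFormUnique :=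
  fun _ _ _ _ _ h ↦ NF.nfSpace_injective h

/-! ### Unit tests (the theorems instantiate at small `s`) -/

/-- `s = 0`: a totally singular Lagrangian line of `P̄₂` with `∅` core is `𝒰(P, b)`. [folklore] -/
example (U : Submodule (ZMod 2) (QVec 0)) (hU : IsTSLagrangian U) (h : CoreQ U ∅) :
    ∃ (P : Position 0) (b : Bool), U = nfSpace P b :=
  normalForm_holds 0 U hU h

/-- `s = 2`: the type bit is an invariant of the Lagrangian. [folklore] -/
example (P P' : Position 2) (b b' : Bool) (h : nfSpace P b = nfSpace P' b') : b = b' :=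
  (normalFormUnique_holds 2 P P' b b' h).2


end Summit.BirchSwinnertonDyer.Rank1Residual.X5.SelmerSolitaire.Quadratic
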